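/-
Width seat `ym-line-sgb-p1-w3` (seat prover-ym-line-sgb-p1-w3-g0-0), route `SteinGapBootstrap`, ASSEMBLY item (stmt-QuantumFields-22997):
the route decl `Assembly`, BY NAME.
-/
import Summits.QuantumFields.YangMills.Theses.SteinGapBootstrap
import Summits.QuantumFields.YangMills.Theorems.SteinGapBootstrapAssemblyPrep
import Summits.QuantumFields.YangMills.Theorems.EquipartitionCriticalityEquipartitionPinsProbeLiePos
import HarnessLib

/-!
# Route `SteinGapBootstrap`, the Assembly (stmt-QuantumFields-22997) — PROVED

NOT THE CLAY GAP: `XiPow` is an UPPER bound on the lattice mass gap of the torus-limit states (RECORD-label rung leaf R2xi-G), and the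
route's load-bearing crux K1 `SteinBlockTransferG` (XL) is a HYPOTHESIS of this implication; nothing here bears on the summit statement.

`Assembly : SteinBlockTransferG → GapGivesClusteringG → PolySmallFieldsG → AxisSymmetryG → XiPow`, the xiDiv-pattern contradiction
of `massGapVanishesOf_allSimpleG` made quantitative.  For a compact simple `G` and faithful unitary `r`: K1 (with the equipartition
constant `C₀` of `PolySmallFieldsG`) yields `K, δ, C, β₀`; put `K₊ = max K 0`, `ε = δ/(2K₊ + 20)`.  For `β` large, a torus-limit state
`μ` and `m` with `HasRPTimeGap μ m`, suppose `m > β^{−ε}`.  K2 turns the gap into the pair clustering (iii) at rate `m`, the supports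
give (i), (ii), so K1 pins the probe covariance `cov(n)` to the free-gluon profile `g_D(n)` within
`C(1 + m⁻¹ + n)^K β^{−δ} ≤ C 6^{K₊} β^{−20ε}` at `n = 2` and `n = 2t`, `t = ⌈β^{2ε}⌉` (`m⁻¹ < β^ε`, `n ≤ 4β^{2ε}`).  The profile floor
(`SteinGapBootstrapAssemblyPrep.profile_floor`: `g_D(n) ≥ A₁ n⁻⁸`, from the tree's `CurvatureCorrPowerFloor`, `D ≥ 1` by `stub_liePos`)
gives `cov(2t) ≥ (A₂/2) β^{−16ε}` and `cov(2) ≤ B₀`; the probe's positive-time shift `P∘α₁` has `rpCorr μ (P∘α₁) k = cov(k+2)`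
(B-TI), so the one-distance spectral bound `HasRPTimeGap.le_log_div` forces `m ≤ (L₀ + 16ε log β)/(2t − 2) ≤ (β^ε/2)/β^{2ε} = β^{−ε}/2`
— contradiction.  Hence `m ≤ β^{−ε}`: `MassGapPowerDecayOf 4 r.ρ ε`, i.e. `XiPow`.

References: the route thesis (Assembly paragraph); S. Chatterjee, arXiv:1803.01950, Problem 5.1 [ChatterjeeYMProb2019];
K. Osterwalder, E. Seiler, Ann. Phys. 110 (1978) §2 [OsterwalderSeiler1978].
-/

set_option autoImplicit false

noncomputable section

open MeasureTheory Filter Topology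
open Literature.MathematicalPhysics
open Literature.MathematicalPhysics.QuantumLattice
open Literature.MathematicalPhysics.QuantumFieldTheory
open Summit.QuantumFields.YangMills.Theorems.WeakCouplingRates

namespace Summit.QuantumFields.YangMills.Theorems.SteinGapBootstrap

open Summit.QuantumFields.YangMills.Theorems.EquipartitionPinsProbe

/-- **The Assembly of route `SteinGapBootstrap` (stmt-QuantumFields-22997), by name**:
`SteinBlockTransferG → GapGivesClusteringG → PolySmallFieldsG → AxisSymmetryG → XiPow` — the xiDiv-pattern contradiction of
`massGapVanishesOf_allSimpleG` made quantitative: with `ε = δ/(2K₊ + 20)`, a gap `m > β^{−ε}` would contract the probe covariance from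
separation `2` to `2⌈β^{2ε}⌉` by `e^{−m(2t−2)} ≤ e^{−β^{ε}}`, while K1 (fed by K2's pair clustering and the two supports) pins both to the
free-gluon profile, whose floor at `2t` is `≳ β^{−16ε}` — impossible for large `β`.  NOT THE CLAY GAP (`XiPow` is an UPPER bound on
the lattice gap; and the route's crux K1 `SteinBlockTransferG` is a HYPOTHESIS here). -/
theorem Assembly_proof : Summit.QuantumFields.YangMills.Theses.SteinGapBootstrap.Assembly := by
  intro hK1 hK2 hS1 hS2 G _ _ _ _ hG
  letI : MeasurableSpace G := borel G
  haveI : BorelSpace G := ⟨rfl⟩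
  intro r
  -- the inputs for this `G`, `r`
  obtain ⟨C₀, β₀s, hS1'⟩ := hS1 G hG r
  obtain ⟨K, δ, C, β₀k, hδ, hC, hK1'⟩ := hK1 G hG r C₀
  have hS2' := hS2 G hG r
  have hK2' := hK2 G hG r
  -- the Lie dimension `D ≥ 1`
  obtain ⟨D, hDdef⟩ : ∃ D : ℝ, D = (Module.finrank ℝ ↥(Submodule.span ℝ {X : Matrix (Fin r.N) (Fin r.N) ℂ |
      ∀ t : ℝ, NormedSpace.exp ((t : ℂ) • X) ∈ Set.range r.ρ}) : ℝ) := ⟨_, rfl⟩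
  have hD1 : 1 ≤ D := by
    rw [hDdef]
    exact_mod_cast stub_liePos G hG r
  have hD0 : 0 ≤ D := zero_le_one.trans hD1
  -- the profile floor and the constants
  obtain ⟨κ, hκ, n₀, hn₀1, hfloor⟩ := profile_floor hD0
  obtain ⟨A₁, hA₁def⟩ : ∃ A : ℝ, A = (2 : ℝ) ^ (-D) * (D / 2) * κ ^ 2 := ⟨_, rfl⟩
  have hA₁ : 0 < A₁ := by
    rw [hA₁def]
    have : 0 < (2 : ℝ) ^ (-D) := Real.rpow_pos_of_pos two_pos _
    positivity
  obtain ⟨A₂, hA₂def⟩ : ∃ A : ℝ, A = A₁ / 4 ^ 8 := ⟨_, rfl⟩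
  have hA₂ : 0 < A₂ := by rw [hA₂def]; positivity
  obtain ⟨g₂, hg₂def⟩ : ∃ x : ℝ, x = (2 : ℝ) ^ (-D) *
      ((1 - (curvaturePlaquetteCorr (d := 4) (by norm_num) ((2 : ℕ) : ℤ)) ^ 2) ^ (-(D / 2)) - 1) := ⟨_, rfl⟩
  have hg₂ : 0 ≤ g₂ := by rw [hg₂def]; exact profile_nonneg hD0 (n := 2) (by norm_num)
  obtain ⟨B₀, hB₀def⟩ : ∃ x : ℝ, x = g₂ + A₂ / 2 := ⟨_, rfl⟩
  have hB₀ : 0 < B₀ := by rw [hB₀def]; linarith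
  obtain ⟨ε, hεdef⟩ : ∃ x : ℝ, x = δ / (2 * max K 0 + 20) := ⟨_, rfl⟩
  have hK0 : 0 ≤ max K 0 := le_max_right _ _
  have hε : 0 < ε := by rw [hεdef]; positivity
  have hδε : δ = ε * (2 * max K 0 + 20) := by
    rw [hεdef]; field_simp
  obtain ⟨L₀, hL₀def⟩ : ∃ x : ℝ, x = Real.log (B₀ / (A₂ / 2)) := ⟨_, rfl⟩
  -- finitely many eventual conditions on `β`
  have hev : ∀ᶠ β : ℝ in atTop, max (max β₀s β₀k) 1 ≤ β ∧ max 2 (n₀ : ℝ) ≤ β ^ (2 * ε) ∧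
      C * (6 : ℝ) ^ (max K 0) * β ^ (-(4 * ε)) ≤ A₂ / 2 ∧ L₀ + 16 * ε * Real.log β ≤ β ^ ε / 2 := by
    refine (eventually_ge_atTop _).and (((tendsto_rpow_atTop (by positivity)).eventually_ge_atTop _).and
      ((eventually_mul_rpow_neg_le (by positivity) _ (half_pos hA₂)).and (eventually_log_le_rpow_half L₀ (16 * ε) hε)))
  obtain ⟨β₁, hβ₁⟩ := Filter.eventually_atTop.1 hev
  refine ⟨ε, hε, β₁, fun β hβ μ hμ m hm => ?_⟩
  obtain ⟨hβa, hβb, hβc, hβd⟩ := hβ₁ β hβ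
  have hβs : β₀s ≤ β := ((le_max_left _ _).trans (le_max_left _ _)).trans hβa
  have hβk : β₀k ≤ β := ((le_max_right _ _).trans (le_max_left _ _)).trans hβa
  have hβ1 : 1 ≤ β := (le_max_right _ _).trans hβa
  have hβ0 : 0 < β := one_pos.trans_le hβ1
  have h2ε2 : 2 ≤ β ^ (2 * ε) := (le_max_left _ _).trans hβb
  have h2εn₀ : (n₀ : ℝ) ≤ β ^ (2 * ε) := (le_max_right _ _).trans hβb
  have hm0 : 0 < m := hm.1
  by_contra hlt
  rw [not_le] at hlt
  -- `m⁻¹ < β^ε`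
  have hβε : 0 < β ^ ε := Real.rpow_pos_of_pos hβ0 ε
  have hminv : m⁻¹ < β ^ ε := by
    refine inv_lt_of_inv_lt₀ hβε ?_
    rwa [← Real.rpow_neg hβ0.le]
  have hε2ε : β ^ ε ≤ β ^ (2 * ε) := Real.rpow_le_rpow_of_exponent_le hβ1 (by linarith)
  -- the probe and its covariance
  obtain ⟨S₀, hPcyl', hS, hPc', hPb'⟩ := probe_facts r.ρ r.continuous β
  obtain ⟨P, hP⟩ : ∃ P : LGConfig 4 G → ℝ, ∀ U, P U =
      Real.exp (-2 * max (β * ((r.N : ℝ) - plaquetteObs r.ρ 0 1 2 U)) 0) := ⟨_, fun _ => rfl⟩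
  have hPfun : P = fun U => Real.exp (-2 * max (β * ((r.N : ℝ) - plaquetteObs r.ρ 0 1 2 U)) 0) := funext hP
  have hPcyl : IsCylinder P S₀ := hPfun ▸ hPcyl'
  have hPc : Continuous P := hPfun ▸ hPc'
  have hPb : ∀ U, |P U| ≤ 1 := fun U => by rw [hP]; exact hPb' U
  obtain ⟨cv, hcv⟩ : ∃ cv : ℕ → ℝ, ∀ n, cv n = (∫ U, P U * P (timeShiftLG (G := G) n U) ∂μ) -
      (∫ U, P U ∂μ) * (∫ U, P (timeShiftLG (G := G) n U) ∂μ) := ⟨_, fun _ => rfl⟩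
  -- K1 for this state (K2 supplies the pair clustering, the supports (i), (ii))
  have hK1β := hK1' β hβk μ hμ (hS1' β hβs μ hμ) (hS2' β μ hμ) m hm0 (hK2' β μ hμ m hm)
  have hK1n : ∀ n : ℕ, 1 ≤ n →
      |cv n - (2 : ℝ) ^ (-D) * ((1 - (curvaturePlaquetteCorr (d := 4) (by norm_num) (n : ℤ)) ^ 2) ^ (-(D / 2)) - 1)| ≤
        C * (1 + m⁻¹ + n) ^ K * β ^ (-δ) := by
    intro n hn
    have h := hK1β n hn
    dsimp only at h
    rw [hcv, hDdef]
    simp only [← hP] at h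
    exact h
  -- `t = ⌈β^{2ε}⌉`, the far separation `2t`
  obtain ⟨t, htdef⟩ : ∃ t : ℕ, t = ⌈β ^ (2 * ε)⌉₊ := ⟨_, rfl⟩
  have ht : β ^ (2 * ε) ≤ t := by rw [htdef]; exact Nat.le_ceil _
  have ht' : (t : ℝ) < β ^ (2 * ε) + 1 := by rw [htdef]; exact Nat.ceil_lt_add_one (Real.rpow_nonneg hβ0.le _)
  have ht2 : 2 ≤ t := by exact_mod_cast h2ε2.trans ht
  have htn₀ : n₀ ≤ 2 * t := by
    have : n₀ ≤ t := by exact_mod_cast h2εn₀.trans ht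
    omega
  have hn1 : 1 ≤ 2 * t := by omega
  have hncast : ((2 * t : ℕ) : ℝ) = 2 * (t : ℝ) := by push_cast; ring
  have hnle : ((2 * t : ℕ) : ℝ) ≤ 4 * β ^ (2 * ε) := by rw [hncast]; linarith
  have ht'cast : ((2 * t - 2 : ℕ) : ℝ) = 2 * (t : ℝ) - 2 := by
    rw [Nat.cast_sub (by omega)]; push_cast; ring
  have ht'ge : β ^ (2 * ε) ≤ ((2 * t - 2 : ℕ) : ℝ) := by rw [ht'cast]; linarith
  have ht'1 : 1 ≤ 2 * t - 2 := by omega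
  -- `X = β^{16ε} ≥ 1`
  have hX : 0 < β ^ (16 * ε) := Real.rpow_pos_of_pos hβ0 _
  have hX1 : 1 ≤ β ^ (16 * ε) := Real.one_le_rpow hβ1 (by positivity)
  have hXinv : β ^ (-(16 * ε)) = (β ^ (16 * ε))⁻¹ := Real.rpow_neg hβ0.le _
  have hXinv1 : β ^ (-(16 * ε)) ≤ 1 := by rw [hXinv]; exact inv_le_one_of_one_le₀ hX1
  -- the error terms at `n = 2` and `n = 2t`
  have hE : ∀ n : ℕ, (n : ℝ) ≤ 4 * β ^ (2 * ε) →
      C * (1 + m⁻¹ + n) ^ K * β ^ (-δ) ≤ A₂ / 2 * β ^ (-(16 * ε)) := by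
    intro n hn
    have hb1 : (1 : ℝ) ≤ 1 + m⁻¹ + n := by
      have : (0 : ℝ) ≤ m⁻¹ := inv_nonneg.2 hm0.le
      have : (0 : ℝ) ≤ n := Nat.cast_nonneg n
      linarith
    have hb : 1 + m⁻¹ + (n : ℝ) ≤ 6 * β ^ (2 * ε) := by linarith
    rw [hδε]
    refine (err_le hC.le hβ1 hb1 hb).trans ?_
    exact mul_le_mul_of_nonneg_right hβc (Real.rpow_nonneg hβ0.le _)
  have hE2 := hE 2 (by push_cast; linarith)
  have hEn := hE (2 * t) hnle
  -- the profile floor at `2t`: `A₂ β^{-16ε} ≤ g(2t)`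
  have hgn : A₂ * β ^ (-(16 * ε)) ≤
      (2 : ℝ) ^ (-D) * ((1 - (curvaturePlaquetteCorr (d := 4) (by norm_num) ((2 * t : ℕ) : ℤ)) ^ 2) ^ (-(D / 2)) - 1) := by
    refine le_trans ?_ (hfloor (2 * t) htn₀)
    rw [← hA₁def]
    have hnpos : (0 : ℝ) < ((2 * t : ℕ) : ℝ) := by exact_mod_cast (by omega : 0 < 2 * t)
    have hpow : ((2 * t : ℕ) : ℝ) ^ 8 ≤ (4 * β ^ (2 * ε)) ^ 8 := pow_le_pow_left₀ hnpos.le hnle 8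
    have h16' : (β ^ (2 * ε)) ^ (8 : ℕ) = β ^ (16 * ε) := by
      rw [← Real.rpow_natCast, ← Real.rpow_mul hβ0.le]
      congr 1
      push_cast
      ring
    have h16 : (4 * β ^ (2 * ε)) ^ 8 = 4 ^ 8 * β ^ (16 * ε) := by rw [mul_pow, h16']
    calc A₂ * β ^ (-(16 * ε)) = A₁ / (4 ^ 8 * β ^ (16 * ε)) := by
          rw [hXinv, hA₂def]; field_simp
      _ ≤ A₁ / ((2 * t : ℕ) : ℝ) ^ 8 := by
          rw [← h16]
          exact div_le_div_of_nonneg_left hA₁.le (pow_pos hnpos 8) hpow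
  -- two-point bounds: far floor and near ceiling
  have hcovn : A₂ / 2 * β ^ (-(16 * ε)) ≤ cv (2 * t) := by
    have h := (abs_le.1 (hK1n (2 * t) hn1)).1
    linarith
  have hcov2 : cv 2 ≤ B₀ := by
    have h := (abs_le.1 (hK1n 2 (by norm_num))).2
    rw [← hg₂def] at h
    rw [hB₀def]
    have : A₂ / 2 * β ^ (-(16 * ε)) ≤ A₂ / 2 := by
      have := mul_le_mul_of_nonneg_left hXinv1 (half_pos hA₂).le
      linarith
    linarith
  -- the spectral bound for the positive-time observable `P ∘ α_1`
  have hF : IsPosTimeObs (fun U => P (timeShiftLG (G := G) 1 U)) := isPosTimeObs_probe_shift hPcyl hS hPc hPb 1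
  have hcorr : ∀ k : ℕ, rpCorr μ (fun U => P (timeShiftLG (G := G) 1 U)) k = cv (k + 1 + 1) := fun k => by
    rw [hcv]; exact rpCorr_probe_shift r.ρ hμ hPcyl hS hPc hPb 1 k
  have hδ' : 0 < A₂ / 2 * β ^ (-(16 * ε)) := mul_pos (half_pos hA₂) (Real.rpow_pos_of_pos hβ0 _)
  have hδ'le : A₂ / 2 * β ^ (-(16 * ε)) ≤ rpCorr μ (fun U => P (timeShiftLG (G := G) 1 U)) (2 * t - 2) := by
    rw [hcorr, show 2 * t - 2 + 1 + 1 = 2 * t by omega]; exact hcovn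
  have hV : rpCorr μ (fun U => P (timeShiftLG (G := G) 1 U)) 0 ≤ B₀ := by
    rw [hcorr]; exact hcov2
  have hgap := hm.le_log_div hF ht'1 hδ' hδ'le hV
  -- `log (B₀ / δ') = L₀ + 16 ε log β`
  have hlog : Real.log (B₀ / (A₂ / 2 * β ^ (-(16 * ε)))) = L₀ + 16 * ε * Real.log β := by
    rw [hXinv, ← div_div, div_inv_eq_mul, Real.log_mul (div_pos hB₀ (half_pos hA₂)).ne' hX.ne',
      Real.log_rpow hβ0, hL₀def]
  rw [hlog] at hgap
  -- conclusion: `m ≤ (β^ε/2)/β^{2ε} = β^{-ε}/2 < β^{-ε} < m`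
  have hnum_nonneg : 0 ≤ L₀ + 16 * ε * Real.log β := by
    by_contra hneg
    rw [not_le] at hneg
    have : m < 0 := hgap.trans_lt (div_neg_of_neg_of_pos hneg (by exact_mod_cast (by omega : 0 < 2 * t - 2)))
    linarith
  have h2εpos : 0 < β ^ (2 * ε) := Real.rpow_pos_of_pos hβ0 _
  have hfin : m ≤ β ^ (-ε) / 2 :=
    calc m ≤ (L₀ + 16 * ε * Real.log β) / ((2 * t - 2 : ℕ) : ℝ) := hgap
      _ ≤ (L₀ + 16 * ε * Real.log β) / β ^ (2 * ε) := div_le_div_of_nonneg_left hnum_nonneg h2εpos ht'ge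
      _ ≤ (β ^ ε / 2) / β ^ (2 * ε) := div_le_div_of_nonneg_right hβd h2εpos.le
      _ = β ^ (-ε) / 2 := by
          rw [div_div, mul_comm, ← div_div, ← Real.rpow_sub hβ0]
          congr 1
          ring_nf
  have hβnε : 0 < β ^ (-ε) := Real.rpow_pos_of_pos hβ0 _
  linarith


end Summit.QuantumFields.YangMills.Theorems.SteinGapBootstrap

end
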